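import Mathlib.Combinatorics.SimpleGraph.Coloring.Vertex
import Mathlib.Data.Set.Card
import Mathlib.Order.SymmDiff
import Literature.Computability.Complexity.FPRAS
import HarnessLib

/-!
# `#DOWNSETS ≡_AP #BIS` (Dyer–Goldberg–Greenhill–Jerrum 2003, Theorem 5 and Lemma 9)

The approximation-preserving interreducibility of the two central problems of the "intermediate"
approximate-counting class of M. Dyer, L. A. Goldberg, C. Greenhill, M. Jerrum, *The relative
complexity of approximate counting problems*, Algorithmica 38 (2003) 471–500 (`DyerEtAl2003`;
page numbers below are those of the held preprint, `lit paper:doi-10-1007-s00453-003-1073-y`),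
stated for the tree's counting functions `downsetCount` (`#DOWNSETS` / two-literal `#1P1NSAT`)
and `bisCount` (`#BIS`) and the tree's AP-reducibility `APReducible` (all in `FPRAS.lean`), as
two named facts, together with the PROVED counting identity behind the easy direction
(a bipartite graph is a height-two order).

The printed results (pp. 8–11):
* **Theorem 5.** "The problems `#BIS`, `#P₄-COL`, `#2-PARTICLE-WR-CONFIGS`, `#BEACHCONFIGS`,
  `#DOWNSETS` and `#1P1NSAT` are all AP-interreducible."  Its proof first disposes of
  `#DOWNSETS ≡_AP #1P1NSAT` (p. 8–9): "`#DOWNSETS` is a restricted version of `#1P1NSAT` in which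
  (a) all clauses have two literals, i.e., are of the form `x ⇒ y`, and (b) there are no cyclic
  chains of implications `x₀ ⇒ x₁ ⇒ ⋯ ⇒ x_{ℓ-1} ⇒ x₀`. But, given an arbitrary instance of
  `#1P1NSAT`, any forced variables as in (a) may be removed by substituting FALSE or TRUE and
  then simplifying; and any set of `ℓ` variables forming a cyclic chain as in (b) may be replaced
  by a single variable", then closes the cycle
  `#BIS ≤_AP #2-PARTICLE-WR-CONFIGS ≤_AP #BEACHCONFIGS ≤_AP #DOWNSETS ≤_AP #BIS` (Lemmas 6–9).
* **Lemma 9.** "`#DOWNSETS ≤_AP #BIS`."  Proof (p. 11): for `(X, ≼)` with `X = [n]` take disjoint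
  `U_i`, `V_i` (`i ∈ X`) with `|U_i| = |V_i| = 2n`, `U = ⋃ U_i`, `V = ⋃ V_i` and
  `E = {(u, v) : u ∈ U_i ∧ v ∈ V_j ∧ i ≼ j}`; an independent set `I` of `B = (U, V, E)` is *full*
  iff `I ∩ (U_i ∪ V_i) ≠ ∅` for all `i`; "every full independent set … corresponds to a downset
  `D = {i ∈ X : I ∩ V_i ≠ ∅}`, and every downset … arises from exactly `(2^{2n} − 1)^n` full
  independent sets `I` in this way; thus `|𝓘'(B)| = (2^{2n} − 1)^n · |𝓓(X, ≼)|`",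
  "`|𝓘(B) ∖ 𝓘'(B)| ≤ 3^n (2^{2n} − 1)^{n−1}`", and since `3^n / (2^{2n} − 1) < 1/4` for `n ≥ 5`,
  `|𝓓(X, ≼)| = ⌊|𝓘(B)| / (2^{2n} − 1)^n⌋`, "and the result follows as in the proof of Theorem 3"
  (one oracle call, divide, round; the accuracy bookkeeping `δ = ε/21` is on p. 6).

Tree form.
* `downsetCount` counts, for an `ℕ`-matrix `M` on `Fin n`, the subsets closed under `i → j`
  (`M i j ≠ 0`); this is `#1P1NSAT` restricted to two-literal clauses and contains `#DOWNSETS`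
  (incidence matrix of `≽`), so by the displayed part of the proof of Theorem 5 it is
  AP-interreducible with both.  `bisCount` is `#BIS` with the (polynomial-time decidable) padding
  "`0` unless the decoded graph is 2-colourable".  `APReducible` is the tree's transcript-model
  rendering of `≤_AP` (`FPRAS.lean`, "Relation to the printed definition"): every coin-free
  reduction whose correctness only uses that all oracle answers are within tolerance — Lemma 9's
  single-query reduction and the parsimonious maps above are of this kind — is an `APReducible`
  witness.
* `DyerEtAl2003.DownsetsAPReducibleBIS : APReducible downsetCount bisCount` (Lemma 9 with
  Theorem 5) and `DyerEtAl2003.BISAPReducibleDownsets : APReducible bisCount downsetCount`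
  (Theorem 5) are NAMED FACTS: the oracle transducers (writing the code of the blown-up graph,
  dividing and rounding; 2-colouring and re-encoding) are not built here.  With
  `HasFPRAS.of_apReducible` (sequel of `FPRAS.lean`) they give the FPRAS implications
  `HasFPRAS bisCount → HasFPRAS downsetCount` — literally the route item
  `Summit.PneNP.PneNP.Theses.BISOrderDimension.IdealsReduceToBIS` — and its converse.
* PROVED here: the counting identity behind `#BIS ≤_AP #DOWNSETS` in its direct form — for a
  bipartite graph with side `A`, `S ↦ S ∆ A` is a bijection between independent sets and the sets
  closed under the implications `i → j` (`i ∉ A`, `j ∈ A`, `ij ∈ E`) of the height-two order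
  (`card_indepSets_eq_card_closedSets`), whence
  `bisCount ⟨n, G⟩ = downsetCount ⟨n, bipartiteImplicationMatrix G A⟩`
  (`bisCount_encode_eq_downsetCount`).  The identities of Lemma 9's blow-up (full independent
  sets are `(2^m − 1)^n`-to-one over the closed sets, the non-full ones are at most
  `3^n (2^m − 1)^{n−1}`, the floor identity) are proved for an arbitrary reflexive relation in the
  sibling file `BISDownsetsBlowup.lean`, and transferred to code words
  (`downsetCount ⟨n, M⟩ = ⌊bisCount ⟨2nm, blow-up⟩ / (2^m − 1)^n⌋`) in `BISDownsetsLemma9.lean`.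

Context, not vendored: Theorem 3 (p. 5: "`#IS ≡_AP #SAT`") and §5 (pp. 12–16: the problems of
Theorem 5 are complete for the logically defined class `#RHΠ₁` under AP-reducibility) — the
reason `#BIS` is conjectured to be of intermediate approximation complexity ("no function
AP-interreducible with `#BIS` is known to admit an FPRAS", p. 2).
-/

namespace Literature.Computability.Complexity

open _root_.Computability Finset
open scoped symmDiff

/-! ### A bipartite graph is a height-two order: independent sets ↔ implication-closed sets -/

section Bipartite

variable {V : Type} [DecidableEq V]

/-- **Independent sets of a bipartite graph are the implication-closed sets of its height-two
order** (the direct form of `#BIS ≤_AP #DOWNSETS`, Theorem 5): if `A` is one side of a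
bipartition of `G` (every edge has exactly one end in `A`), then `S ↦ S ∆ A` is a bijection from
the independent sets of `G` onto the sets `I` closed under `i ∈ I, i ∉ A, j ∈ A, ij ∈ E ⇒ j ∈ I`
(its inverse is again `I ↦ I ∆ A`); in particular the two families are equinumerous.
[cite: DyerEtAl2003, Theorem 5] -/
theorem card_indepSets_eq_card_closedSets [Fintype V] (G : SimpleGraph V) [DecidableRel G.Adj]
    (A : Finset V) (hA : ∀ ⦃v w : V⦄, G.Adj v w → (v ∈ A ↔ w ∉ A)) :
    (univ.filter fun S : Finset V => ∀ a ∈ S, ∀ b ∈ S, ¬ G.Adj a b).card =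
      (univ.filter fun I : Finset V =>
        ∀ i ∈ I, ∀ j : V, (i ∉ A ∧ j ∈ A ∧ G.Adj i j) → j ∈ I).card := by
  refine Finset.card_bij' (fun S _ => S ∆ A) (fun I _ => I ∆ A) ?_ ?_
    (fun S _ => symmDiff_symmDiff_cancel_right A S)
    (fun I _ => symmDiff_symmDiff_cancel_right A I)
  · intro S hS
    simp only [Finset.mem_filter, Finset.mem_univ, true_and] at hS ⊢
    rintro i hi j ⟨hiA, hjA, hij⟩
    rw [Finset.mem_symmDiff] at hi ⊢
    have hiS : i ∈ S := by
      rcases hi with ⟨h, -⟩ | ⟨h, -⟩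
      · exact h
      · exact absurd h hiA
    exact Or.inr ⟨hjA, fun hjS => hS i hiS j hjS hij⟩
  · intro I hI
    simp only [Finset.mem_filter, Finset.mem_univ, true_and] at hI ⊢
    intro a ha b hb hab
    rw [Finset.mem_symmDiff] at ha hb
    have key : ∀ ⦃v w : V⦄, G.Adj v w → v ∉ A → (v ∈ I ∧ v ∉ A ∨ v ∈ A ∧ v ∉ I) →
        (w ∈ I ∧ w ∉ A ∨ w ∈ A ∧ w ∉ I) → False := by
      intro v w hvw hvA hv hw
      have hwA : w ∈ A := by
        by_contra h
        exact hvA ((hA hvw).2 h)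
      have hvI : v ∈ I := by
        rcases hv with ⟨h, -⟩ | ⟨h, -⟩
        · exact h
        · exact absurd h hvA
      have hwI : w ∉ I := by
        rcases hw with ⟨-, h⟩ | ⟨-, h⟩
        · exact absurd hwA h
        · exact h
      exact hwI (hI v hvI w ⟨hvA, hwA, hvw⟩)
    by_cases haA : a ∈ A
    · exact key hab.symm ((hA hab).1 haA) hb ha
    · exact key hab haA ha hb

/-- The implication matrix of a bipartite graph on `Fin n` with side `A`: `M i j = 1` iff `i ∉ A`,
`j ∈ A` and `ij` is an edge (the height-two order `i ≻ j`), else `0`. [folklore] -/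
def bipartiteImplicationMatrix {n : ℕ} (G : SimpleGraph (Fin n)) [DecidableRel G.Adj]
    (A : Finset (Fin n)) : Fin n → Fin n → ℕ :=
  fun i j => if i ∉ A ∧ j ∈ A ∧ G.Adj i j then 1 else 0

/-- Unfolding lemma: the entry `(i, j)` of the implication matrix is nonzero iff `i ∉ A`, `j ∈ A`
and `G.Adj i j`. [folklore] -/
theorem bipartiteImplicationMatrix_ne_zero_iff {n : ℕ} (G : SimpleGraph (Fin n))
    [DecidableRel G.Adj] (A : Finset (Fin n)) (i j : Fin n) :
    bipartiteImplicationMatrix G A i j ≠ 0 ↔ i ∉ A ∧ j ∈ A ∧ G.Adj i j := by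
  simp [bipartiteImplicationMatrix]

/-- Every edge has exactly one end in a bipartition side, so such a graph is 2-colourable (colour
by membership in `A`). [folklore] -/
theorem colorable_two_of_side {W : Type} (G : SimpleGraph W) (A : Finset W)
    (hA : ∀ ⦃v w : W⦄, G.Adj v w → (v ∈ A ↔ w ∉ A)) : G.Colorable 2 := by
  classical
  refine ⟨SimpleGraph.Coloring.mk (fun v => if v ∈ A then 0 else 1) ?_⟩
  intro v w hvw
  by_cases hv : v ∈ A
  · have hw : w ∉ A := (hA hvw).1 hv
    simp [hv, hw]
  · have hw : w ∈ A := by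
      by_contra hw
      exact hv ((hA hvw).2 hw)
    simp [hv, hw]

/-- A 2-colouring provides a bipartition side: the colour class of `0`. [folklore] -/
theorem exists_side_of_colorable_two {W : Type} [Fintype W] (G : SimpleGraph W)
    (h : G.Colorable 2) :
    ∃ A : Finset W, ∀ ⦃v w : W⦄, G.Adj v w → (v ∈ A ↔ w ∉ A) := by
  classical
  obtain ⟨c⟩ := h
  refine ⟨univ.filter fun v => c v = 0, fun v w hvw => ?_⟩
  have hne : c v ≠ c w := c.valid hvw
  simp only [Finset.mem_filter, Finset.mem_univ, true_and]
  constructor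
  · intro hv hw
    exact hne (hv.trans hw.symm)
  · intro hw
    have h2 : ∀ x : Fin 2, x = 0 ∨ x = 1 := by decide
    rcases h2 (c v) with hv | hv
    · exact hv
    · rcases h2 (c w) with hw' | hw'
      · exact absurd hw' hw
      · exact absurd (hv.trans hw'.symm) hne

/-- **`#BIS` is a special case of `#DOWNSETS`, on code words**: for a bipartite graph `G` on
`Fin n` with side `A`, `bisCount ⟨n, G⟩ = downsetCount ⟨n, M⟩` for the implication matrix `M`
of `(G, A)` — the counting identity of the direct reduction `#BIS ≤_AP #DOWNSETS` (Theorem 5); the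
polynomial-time 2-colouring and re-encoding are not formalised here.
[cite: DyerEtAl2003, Theorem 5] -/
theorem bisCount_encode_eq_downsetCount {n : ℕ} (G : SimpleGraph (Fin n)) [DecidableRel G.Adj]
    (A : Finset (Fin n)) (hA : ∀ ⦃v w : Fin n⦄, G.Adj v w → (v ∈ A ↔ w ∉ A)) :
    bisCount (encodingGraph.encode ⟨n, G⟩) =
      downsetCount (encodingNatMatrix.encode ⟨n, bipartiteImplicationMatrix G A⟩) := by
  rw [bisCount_encode_of_colorable (colorable_two_of_side G A hA), downsetCount_encode_eq_card]
  convert card_indepSets_eq_card_closedSets G A hA using 4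
  simp [bipartiteImplicationMatrix]

/-- Hence, for every 2-colourable graph on `Fin n`, `bisCount ⟨n, G⟩` is a value of `downsetCount`
on an instance of the same size `n`. [cite: DyerEtAl2003, Theorem 5] -/
theorem exists_downsetCount_eq_bisCount {n : ℕ} (G : SimpleGraph (Fin n)) (hG : G.Colorable 2) :
    ∃ M : Fin n → Fin n → ℕ,
      bisCount (encodingGraph.encode ⟨n, G⟩) = downsetCount (encodingNatMatrix.encode ⟨n, M⟩) := by
  classical
  obtain ⟨A, hA⟩ := exists_side_of_colorable_two G hG
  exact ⟨bipartiteImplicationMatrix G A, bisCount_encode_eq_downsetCount G A hA⟩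

end Bipartite

/-! ### The named facts -/

namespace DyerEtAl2003

/-- **Dyer–Goldberg–Greenhill–Jerrum 2003, Lemma 9 (with Theorem 5): `#DOWNSETS ≤_AP #BIS`.**
"Lemma 9. `#DOWNSETS ≤_AP #BIS`", extended from partial orders to arbitrary implication digraphs
by the proof of Theorem 5 ("any set of `ℓ` variables forming a cyclic chain … may be replaced by a
single variable. So `#DOWNSETS` and `#1P1NSAT` are certainly AP-interreducible"). In tree terms:
`downsetCount` (implication-closed subsets of an `ℕ`-matrix on `Fin n`; two-literal `#1P1NSAT`)
is AP-reducible to `bisCount` (`#BIS`, padded by `0` off bipartite code words). The reduction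
(p. 11): blow every point `i` up into blocks `U_i`, `V_i` of size `2n`, join `U_i`–`V_j` completely
iff `i ≼ j`, make ONE oracle call for the number of independent sets of this bipartite graph,
divide by `(2^{2n} − 1)^n` and round — full independent sets are `(2^{2n} − 1)^n`-to-one over
downsets and the others number at most `3^n (2^{2n} − 1)^{n−1} < (2^{2n} − 1)^n / 4` for `n ≥ 5`
(identities proved in `BISDownsetsBlowup.lean`; accuracy bookkeeping as in the proof of
Theorem 3, p. 6). A coin-free single-query reduction, hence an `APReducible` witness
(`FPRAS.lean`, `APReducible.intro_of_forall`). Stated as a `Prop`: the oracle transducer is not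
built in the tree. [cite: DyerEtAl2003, Lemma 9 and Theorem 5] -/
def DownsetsAPReducibleBIS : Prop :=
  APReducible downsetCount bisCount

/-- **Dyer–Goldberg–Greenhill–Jerrum 2003, Theorem 5, direction `#BIS ≤_AP #DOWNSETS`.**
"Theorem 5. The problems `#BIS`, `#P₄-COL`, `#2-PARTICLE-WR-CONFIGS`, `#BEACHCONFIGS`, `#DOWNSETS`
and `#1P1NSAT` are all AP-interreducible" — printed via the chain of Lemmas 6–8
(`#BIS ≤_AP #2-PARTICLE-WR-CONFIGS ≤_AP #BEACHCONFIGS ≤_AP #DOWNSETS`); directly, a bipartite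
graph with side `A` is the height-two order `i ≻ j ⇔ i ∉ A, j ∈ A, ij ∈ E`, whose
implication-closed sets are in bijection with the independent sets by `S ↦ S ∆ A`
(`bisCount_encode_eq_downsetCount`, proved above), after a polynomial-time 2-colouring — a
parsimonious, coin-free reduction. In tree terms: `bisCount` is AP-reducible to `downsetCount`.
Stated as a `Prop`: the 2-colouring/re-encoding transducer is not built in the tree.
[cite: DyerEtAl2003, Theorem 5] -/
def BISAPReducibleDownsets : Prop :=
  APReducible bisCount downsetCount

end DyerEtAl2003

end Literature.Computability.Complexity
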